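import Mathlib
import Summits.Langlands.Langlands.Theorems.PicardMuOrdinaryResidualAutomorphyOddPGL
import HarnessLib

/-!
# The branch-point table of `S₄ ≅ PGL₂(𝔽₃)` (helper for item stmt-Langlands-13759, route PicardMuOrdinary)

For `g ∈ GL₂(𝔽₃)` inducing `σ ∈ S₄` on `ℙ¹(𝔽₃)` and any lift `c·g` of its class to `GL₂(L)`, `L ⊇ 𝔽₃` a
field: with `u = tr² / det`, the polynomials `redPoly₁ (tr) (det) (sign σ) = (X - s)(X² - s(u-2)X + 1)` and
`redPoly₂ (tr) (det) = (X - 1)(X² - ((u-2)²-2)X + 1)` are the table polynomials `cycleTable` of `σ` and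
`σ²` read through the number of fixed points and the parity (`table_poly`).  The cycle type of an
element of `S₄` is determined by the fixed points of `σ`, `σ²` (`sign_eq_neg_one_iff`).  Also: the
finite group-theoretic checks in `S₄` / `GL₂(𝔽₃)` used by the Galois side (squares in subgroups of
order divisible by `12`, matrices inducing the double transpositions, trace-good permutations), the
route's table polynomial `tablePoly` read on a finite field, and the place `placeOf p` of `ℚ`.
-/

set_option linter.dupNamespace false -- project-wide option (lakefile weak.linter.dupNamespace); `Summit.Langlands.Langlands` is the mandated namespace

noncomputable section

open scoped MatrixGroups Polynomial
open Polynomial Matrix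

namespace Summit.Langlands.Langlands.Theorems.ResidualAutomorphyOdd

/-! ### The table data -/

/-- Number of fixed points of the action, from the entries. -/
def fixN (a b c d : F3) : ℕ := (Finset.univ.filter fun i => actFin a b c d i = i).card

/-- `u = t²/δ = t² δ` (`δ = ±1`), from the entries. -/
def uOf (a b c d : F3) : F3 := (a + d) ^ 2 * (a * d - b * c)

/-- The classification of the `48` elements of `GL₂(𝔽₃)` by `(u, #Fix(g), #Fix(g²))`. -/
theorem table_data (a b c d : F3) (h : a * d - b * c ≠ 0) :
    (uOf a b c d = 1 ∧ fixN a b c d = 4 ∧ fixN (a * a + b * c) (a * b + b * d) (c * a + d * c) (c * b + d * d) = 4) ∨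
    (uOf a b c d = 0 ∧ fixN a b c d = 2 ∧ fixN (a * a + b * c) (a * b + b * d) (c * a + d * c) (c * b + d * d) = 4) ∨
    (uOf a b c d = 0 ∧ fixN a b c d = 0 ∧ fixN (a * a + b * c) (a * b + b * d) (c * a + d * c) (c * b + d * d) = 4) ∨
    (uOf a b c d = 1 ∧ fixN a b c d = 1 ∧ fixN (a * a + b * c) (a * b + b * d) (c * a + d * c) (c * b + d * d) = 1) ∨
    (uOf a b c d = 2 ∧ fixN a b c d = 0 ∧ fixN (a * a + b * c) (a * b + b * d) (c * a + d * c) (c * b + d * d) = 0) := by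
  revert h; revert a b c d; decide

/-- Number of fixed points of a permutation of `Fin 4`. -/
def fixCard (σ : Equiv.Perm (Fin 4)) : ℕ := (Finset.univ.filter fun i => σ i = i).card

/-- Cycle types of `S₄` are determined by the numbers of fixed points of `σ` and `σ²`; the parity. -/
theorem sign_eq_neg_one_iff (σ : Equiv.Perm (Fin 4)) :
    Equiv.Perm.sign σ = -1 ↔ (fixCard σ = 2 ∧ fixCard (σ ^ 2) = 4) ∨ (fixCard σ = 0 ∧ fixCard (σ ^ 2) = 0) := by
  revert σ; decide

/-- Fixed points of the permutation of `g`, from the entries. -/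
theorem fixCard_permHom (g : GL (Fin 2) F3) :
    fixCard (permHom g) = fixN (g 0 0) (g 0 1) (g 1 0) (g 1 1) := by
  unfold fixCard fixN
  congr 1
  ext i
  simp only [Finset.mem_filter, Finset.mem_univ, true_and, permHom_apply]

/-- Fixed points of the square of the permutation of `g`, from the entries of `g²`. -/
theorem fixCard_permHom_sq (g : GL (Fin 2) F3) :
    fixCard (permHom g ^ 2) =
      fixN (g 0 0 * g 0 0 + g 0 1 * g 1 0) (g 0 0 * g 0 1 + g 0 1 * g 1 1)
        (g 1 0 * g 0 0 + g 1 1 * g 1 0) (g 1 0 * g 0 1 + g 1 1 * g 1 1) := by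
  rw [← map_pow, fixCard_permHom]
  congr 1 <;> simp [sq, Matrix.mul_apply, Fin.sum_univ_two]

/-! ### The table polynomials -/

/-- The reduced Hecke polynomial at a place of residue degree `1`, in terms of the Frobenius trace
`t`, determinant `d` and sign `s`: `(X - s)(X² - s(t²/d - 2)X + 1)`. -/
def redPoly₁ {L : Type*} [Field L] (t d s : L) : L[X] :=
  (X - C s) * (X ^ 2 - C (s * (t ^ 2 / d - 2)) * X + 1)

/-- The reduced Hecke polynomial at a place of residue degree `2`:
`(X - 1)(X² - ((t²/d - 2)² - 2)X + 1)`. -/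
def redPoly₂ {L : Type*} [Field L] (t d : L) : L[X] :=
  (X - 1) * (X ^ 2 - C ((t ^ 2 / d - 2) ^ 2 - 2) * X + 1)

/-- The branch-point table by number of fixed points and parity of a permutation of four letters. -/
def cycleTable (n : ℕ) (ev : Bool) : ℤ[X] :=
  if n = 4 then (X - 1) ^ 3 else if n = 2 then (X - 1) ^ 2 * (X + 1) else if n = 1 then X ^ 3 - 1
  else if ev then (X - 1) * (X + 1) ^ 2 else X ^ 3 + X ^ 2 + X + 1

section TablePoly

variable {L : Type*} [Field L] [CharP L 3]

/-- `3 = 0` in `L[X]` for `char L = 3`. -/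
theorem three_eq_zero_poly : (3 : L[X]) = 0 := by
  have h : ((3 : ℕ) : L) = 0 := CharP.cast_eq_zero L 3
  rw [Nat.cast_ofNat] at h
  rw [← map_ofNat (C : L →+* L[X]) 3, h, map_zero]

/-- `det g ^ 2 = 1` in `L ⊇ 𝔽₃`. -/
theorem castHom_det_sq (g : GL (Fin 2) F3) :
    (ZMod.castHom (dvd_refl 3) L (g 0 0 * g 1 1 - g 0 1 * g 1 0)) ^ 2 = 1 := by
  rw [← map_pow]
  have h : ∀ x : F3, x ≠ 0 → x ^ 2 = 1 := by decide
  rw [h _ (det_entries g), map_one]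

/-- `det g ≠ 0` in `L ⊇ 𝔽₃`. -/
theorem castHom_det_ne_zero (g : GL (Fin 2) F3) :
    ZMod.castHom (dvd_refl 3) L (g 0 0 * g 1 1 - g 0 1 * g 1 0) ≠ 0 := by
  intro h
  have h2 := castHom_det_sq (L := L) g
  rw [h] at h2
  norm_num at h2

/-- `t²/d = u` for the rescaled image of `g`. -/
theorem sq_div_eq_uOf (g : GL (Fin 2) F3) {c : L} (hc : c ≠ 0) :
    (c * ZMod.castHom (dvd_refl 3) L (g 0 0 + g 1 1)) ^ 2 /
        (c ^ 2 * ZMod.castHom (dvd_refl 3) L (g 0 0 * g 1 1 - g 0 1 * g 1 0)) =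
      ZMod.castHom (dvd_refl 3) L (uOf (g 0 0) (g 0 1) (g 1 0) (g 1 1)) := by
  have hd := castHom_det_ne_zero (L := L) g
  have hd2 := castHom_det_sq (L := L) g
  rw [uOf, map_mul, map_pow, div_eq_iff (mul_ne_zero (pow_ne_zero 2 hc) hd)]
  calc (c * ZMod.castHom (dvd_refl 3) L (g 0 0 + g 1 1)) ^ 2
      = c ^ 2 * (ZMod.castHom (dvd_refl 3) L (g 0 0 + g 1 1)) ^ 2 * 1 := by ring
    _ = _ := by rw [← hd2]; ring

/-- **The table**: for `g ∈ GL₂(𝔽₃)` with image `σ ∈ S₄` under the action on `ℙ¹(𝔽₃)`, and any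
lift `c · g` of its class to `GL₂(L)` (`L ⊇ 𝔽₃`), the reduced Hecke polynomials attached to
`(tr, det, sign σ)` are the branch-point characteristic polynomials of `σ` and `σ²`. -/
theorem table_poly (g : GL (Fin 2) F3) {c : L} (hc : c ≠ 0) :
    redPoly₁ (c * ZMod.castHom (dvd_refl 3) L (g 0 0 + g 1 1))
        (c ^ 2 * ZMod.castHom (dvd_refl 3) L (g 0 0 * g 1 1 - g 0 1 * g 1 0))
        (((Equiv.Perm.sign (permHom g) : ℤˣ) : ℤ) : L) =
      (cycleTable (fixCard (permHom g)) (decide (Equiv.Perm.sign (permHom g) = 1))).map (Int.castRingHom L) ∧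
    redPoly₂ (c * ZMod.castHom (dvd_refl 3) L (g 0 0 + g 1 1))
        (c ^ 2 * ZMod.castHom (dvd_refl 3) L (g 0 0 * g 1 1 - g 0 1 * g 1 0)) =
      (cycleTable (fixCard (permHom g ^ 2)) true).map (Int.castRingHom L) := by
  have hu := sq_div_eq_uOf (L := L) g hc
  have h3 := three_eq_zero_poly (L := L)
  have hsg := sign_eq_neg_one_iff (permHom g)
  rw [fixCard_permHom, fixCard_permHom_sq] at hsg
  rw [fixCard_permHom, fixCard_permHom_sq]
  have hdata := table_data (g 0 0) (g 0 1) (g 1 0) (g 1 1) (det_entries g)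
  have hs1 : Equiv.Perm.sign (permHom g) ≠ -1 → Equiv.Perm.sign (permHom g) = 1 :=
    fun h => (Int.units_eq_one_or _).resolve_right h
  have hdm1 : decide ((-1 : ℤˣ) = 1) = false := by decide
  unfold redPoly₁ redPoly₂
  rw [hu]
  rcases hdata with ⟨hU, h1, h2⟩ | ⟨hU, h1, h2⟩ | ⟨hU, h1, h2⟩ | ⟨hU, h1, h2⟩ | ⟨hU, h1, h2⟩
  · -- scalars: `u = 1`, `σ = 1`
    rw [h1, h2] at hsg ⊢
    have hsign : Equiv.Perm.sign (permHom g) = 1 := hs1 fun h => absurd (hsg.1 h) (by decide)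
    rw [hU, map_one, hsign]
    simp [cycleTable, Polynomial.C_ofNat]
    constructor
    · linear_combination (X ^ 2 - X : L[X]) * h3
    · linear_combination (X ^ 2 - X : L[X]) * h3
  · -- transpositions: `u = 0`
    rw [h1, h2] at hsg ⊢
    have hsign : Equiv.Perm.sign (permHom g) = -1 := hsg.2 (by decide)
    rw [hU, map_zero, hsign]
    simp [cycleTable, Polynomial.C_ofNat]
    constructor
    · ring1
    · ring1
  · -- double transpositions: `u = 0`
    rw [h1, h2] at hsg ⊢
    have hsign : Equiv.Perm.sign (permHom g) = 1 := hs1 fun h => absurd (hsg.1 h) (by decide)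
    rw [hU, map_zero, hsign]
    simp [cycleTable, Polynomial.C_ofNat]
    constructor
    · exact Or.inl (by ring1)
    · ring1
  · -- three-cycles: `u = 1`
    rw [h1, h2] at hsg ⊢
    have hsign : Equiv.Perm.sign (permHom g) = 1 := hs1 fun h => absurd (hsg.1 h) (by decide)
    rw [hU, map_one, hsign]
    simp [cycleTable, Polynomial.C_ofNat]
    constructor
    · linear_combination (0 : L[X]) * h3
    · linear_combination (0 : L[X]) * h3
  · -- four-cycles: `u = 2`
    rw [h1, h2] at hsg ⊢
    have hsign : Equiv.Perm.sign (permHom g) = -1 := hsg.2 (by decide)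
    rw [hU, map_ofNat, hsign]
    simp [cycleTable, Polynomial.C_ofNat]
    constructor
    · ring1
    · exact Or.inl (by ring1)

end TablePoly

/-! ### Finite group-theoretic checks in `S₄` and `GL₂(𝔽₃)` -/

/-- In a subgroup of `S₄` of order divisible by `12`, every square lies. -/
theorem mul_self_mem_of_twelve_dvd (H : Subgroup (Equiv.Perm (Fin 4))) (h12 : 12 ∣ Nat.card H)
    (τ : Equiv.Perm (Fin 4)) : τ * τ ∈ H := by
  have hcard : Nat.card (Equiv.Perm (Fin 4)) = 24 := by
    rw [Nat.card_eq_fintype_card, Fintype.card_perm, Fintype.card_fin]; rfl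
  have hmul := H.card_mul_index
  rw [hcard] at hmul
  obtain ⟨k, hk⟩ := h12
  rw [hk, mul_assoc] at hmul
  have hk' : k * H.index = 2 := Nat.eq_of_mul_eq_mul_left (by norm_num : 0 < 12) (by omega)
  rcases (Nat.dvd_prime Nat.prime_two).1 (Dvd.intro_left k hk') with h1 | h2
  · rw [Subgroup.index_eq_one] at h1
    rw [h1]; exact Subgroup.mem_top _
  · exact Subgroup.mul_self_mem_of_index_two h2 τ

/-- Matrices inducing the double transposition `(0 1)(2 3)` are the multiples of `(0 -1; 1 0)`. -/
theorem entries_of_actFin_eq_dA (a b c d : F3) (hdet : a * d - b * c ≠ 0)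
    (h : ∀ i, actFin a b c d i = (Equiv.swap (0 : Fin 4) 1 * Equiv.swap 2 3 : Equiv.Perm (Fin 4)) i) :
    a = 0 ∧ d = 0 ∧ c = -b := by
  revert hdet h; revert a b c d; decide

/-- Matrices inducing the double transposition `(0 2)(1 3)` are the multiples of `(1 1; 1 -1)`. -/
theorem entries_of_actFin_eq_dB (a b c d : F3) (hdet : a * d - b * c ≠ 0)
    (h : ∀ i, actFin a b c d i = (Equiv.swap (0 : Fin 4) 2 * Equiv.swap 1 3 : Equiv.Perm (Fin 4)) i) :
    b = a ∧ c = a ∧ d = -a := by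
  revert hdet h; revert a b c d; decide

/-- The trace of `g ∈ GL₂(𝔽₃)` is non-zero iff the permutation of `g` is in `TrOK` (finite check). -/
theorem trace_ne_zero_iff_entries (a b c d : F3) (hdet : a * d - b * c ≠ 0) :
    a + d ≠ 0 ↔ (fixN a b c d = 4 ∨ fixN a b c d = 1 ∨ (fixN a b c d = 0 ∧
      fixN (a * a + b * c) (a * b + b * d) (c * a + d * c) (c * b + d * d) = 0)) := by
  revert hdet; revert a b c d; decide

/-- Permutations whose lifts to `GL₂(𝔽₃)` have non-zero trace are the identity, the `3`-cycles and
the `4`-cycles, read through fixed points of `π` and `π²` ("`π` is trace-good").  For every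
`π₀ ∈ S₄`, either `π₀` is trace-good or `π₀ ζ` is, for some `3`-cycle `ζ` (finite check). -/
theorem trOK_or_exists_threeCycle (π₀ : Equiv.Perm (Fin 4)) :
    (fixCard π₀ = 4 ∨ fixCard π₀ = 1 ∨ (fixCard π₀ = 0 ∧ fixCard (π₀ ^ 2) = 0)) ∨
      ∃ ζ : Equiv.Perm (Fin 4), fixCard ζ = 1 ∧
        (fixCard (π₀ * ζ) = 4 ∨ fixCard (π₀ * ζ) = 1 ∨ (fixCard (π₀ * ζ) = 0 ∧ fixCard ((π₀ * ζ) ^ 2) = 0)) := by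
  unfold fixCard; revert π₀; decide

/-- A `3`-cycle is the square of its square (finite check). -/
theorem threeCycle_eq_sq_sq (ζ : Equiv.Perm (Fin 4)) (h : fixCard ζ = 1) : ζ * ζ * (ζ * ζ) = ζ := by
  unfold fixCard at h; revert h; revert ζ; decide

/-! ### The table polynomial of the route and the place of a rational prime -/

section RouteTable

open scoped Classical NumberField
open IsDedekindDomain

/-- The branch-point table of the route, read on an arbitrary finite field `F`. -/
def tablePoly (F : Type) [CommRing F] [IsDomain F] (f : ℤ[X]) : ℤ[X] :=
  if (f.map (Int.castRingHom F)).roots.toFinset.card = 4 then (X - 1) ^ 3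
  else if (f.map (Int.castRingHom F)).roots.toFinset.card = 2 then (X - 1) ^ 2 * (X + 1)
  else if (f.map (Int.castRingHom F)).roots.toFinset.card = 1 then X ^ 3 - 1
  else if ∃ y : F, y ^ 2 = (f.map (Int.castRingHom F)).discr then (X - 1) * (X + 1) ^ 2
  else X ^ 3 + X ^ 2 + X + 1

/-- The finite place of `ℚ` attached to a rational prime. -/
def placeOf (p : ℕ) (hp : p.Prime) : HeightOneSpectrum (𝓞 ℚ) :=
  (Rat.HeightOneSpectrum.primesEquiv (R := 𝓞 ℚ)).symm ⟨p, hp⟩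

/-- `primesEquiv (placeOf p) = p`. -/
theorem primesEquiv_placeOf (p : ℕ) (hp : p.Prime) :
    ((Rat.HeightOneSpectrum.primesEquiv (placeOf p hp) : Nat.Primes) : ℕ) = p := by
  rw [placeOf, Equiv.apply_symm_apply]

end RouteTable

end Summit.Langlands.Langlands.Theorems.ResidualAutomorphyOdd
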